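import Summits.CriticalPhenomena.SAWScalingLimit.Theorems.SAWTotalPositivityTPToTraversalBoundChainTransfer
import Summits.CriticalPhenomena.SAWScalingLimit.Theorems.SAWTotalPositivityTPToTraversalBoundTopHeavinessAux
import Summits.CriticalPhenomena.SAWScalingLimit.Theorems.SAWTotalPositivityTPToTraversalBoundTopHeavinessTransfer

/-!
# Top state of the radial chain (`TopHeaviness`), part III: the residual analytic input

Crux `SAWTotalPositivity.TPToTraversalBound` (stmt-CriticalPhenomena-10687), line `radial-portal-transfer`,
stub `stub_topHeaviness : TopHeaviness` — NOT proved here (open: a one-scale statement of the strength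
of Kemppainen–Smirnov's Condition G2 / Aizenman–Burchard's (H1) at ONE aspect ratio for the chordal
critical square-lattice SAW; nothing of the kind is in print).  This file isolates its EXACT analytic
content in the Aizenman–Burchard vocabulary of the crux and proves the equivalence:

* `DeepTraversalTail κ L` — for every Dobrushin domain and endpoint approximation there are
  `C, c₁ > 0, δ₀ > 0` with
  `P_δ(the mesh polyline traverses D(x; r, κ r) k separate times) ≤ C e^{-c₁ k}` for all `δ ≤ δ₀`,
  `r ≥ δ` and `closedBall x (L r) ⊆ D` (an EXPONENTIAL TAIL IN THE TRAVERSAL COUNT at ONE aspect ratio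
  for DEEP interior annuli, constants depending on `(D, a, b)`; compare `InteriorShellBound` /
  `SAWTraversalBound` = power law in the ratio for a shell-dependent count);
* `topHeaviness_of_traversalTail` : `DeepTraversalTail 20 100 → TopHeaviness` (union bound over the
  `≤ 1025²` catalogue annuli of `exists_hasTraversals_of_hasPieces`, part II, after the small-box /
  small-count reduction `topHeaviness_of_largeBox`, part I);
* `deepTraversalTail_of_topHeaviness` : `TopHeaviness → DeepTraversalTail 20 100` (the landed
  `stub_chain_transfer`: `2j` traversals of `D(x; r, 20 r)` give `j` big pieces off the box
  `B_∞(nearestSite x, ⌊r/δ⌋ + 4)`, clean inside `closedBall x (21 r)`);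
* `topHeaviness_iff_deepTraversalTail` : `TopHeaviness ↔ DeepTraversalTail 20 100`, and
  `DeepTraversalTail.mono` (smaller ratio / shallower annuli is stronger).

So the registered stub is EQUIVALENT to the fixed-ratio traversal tail; the line's census can name
`DeepTraversalTail 20 100` (≡ `TopHeaviness`) as its top-state input.
-/

noncomputable section

open MeasureTheory Filter Topology Set Metric
open scoped NNReal ENNReal unitInterval
open Literature.Probability.LatticeModels
open Literature.Probability.RandomPlanarGeometry
open Literature.Probability.RandomPlanarGeometry.SAW
open Summit.CriticalPhenomena.SAWScalingLimit.Theses.SAWTotalPositivity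

namespace Summit.CriticalPhenomena.SAWScalingLimit.Theorems.TPToTraversalBound.Radial

variable {Ω : Set ℂ} {δ : ℝ} {u v : Site 2}

/-! ## The residual analytic input -/

/-- **Fixed-ratio traversal tail for deep interior annuli** (the analytic content of the top state
of the radial chain).  For every Dobrushin domain and endpoint approximation there are `C`, `c₁ > 0`,
`δ₀ > 0` such that for every mesh `δ ≤ δ₀`, radius `r ≥ δ` and centre `x` with
`closedBall x (L r) ⊆ D`, the mesh polyline of the chordal critical SAW traverses the annulus
`D(x; r, κ r)` `k` separate times (`Curve.HasTraversals`, Aizenman–Burchard's `k`-fold crossings)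
with probability `≤ C e^{-c₁ k}`.  Proposition only; nothing is asserted. -/
def DeepTraversalTail (κ L : ℝ) : Prop :=
  ∀ (D : DobrushinDomain) (a b : ℝ → Site 2), IsEndpointApprox D a b →
    ∃ (C c₁ δ₀ : ℝ), 0 < c₁ ∧ 0 < δ₀ ∧ ∀ δ ∈ Set.Ioc (0 : ℝ) δ₀, ∀ (x : ℂ) (r : ℝ) (k : ℕ),
      δ ≤ r → Metric.closedBall x (L * r) ⊆ D.carrier →
        law D.carrier δ (a δ) (b δ)
            {γ | (⟨γ.walk.toCurve (meshPoint δ)⟩ : Curve ℂ).HasTraversals k x r (κ * r)} ≤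
          ENNReal.ofReal (C * Real.exp (-(c₁ * k)))

/-- Monotonicity: a smaller aspect ratio and a smaller depth requirement give a STRONGER statement
(more traversal events, more annuli). [cite: AizenmanBurchard1999, §3.a] -/
theorem DeepTraversalTail.mono {κ κ' L L' : ℝ} (h : DeepTraversalTail κ L) (hκ : κ ≤ κ')
    (hL : L ≤ L') : DeepTraversalTail κ' L' := by
  intro D a b hab
  obtain ⟨C, c₁, δ₀, hc₁, hδ₀, h⟩ := h D a b hab
  refine ⟨C, c₁, δ₀, hc₁, hδ₀, fun δ hδ x r k hδr hball => ?_⟩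
  have hr : 0 ≤ r := hδ.1.le.trans hδr
  have hball' : Metric.closedBall x (L * r) ⊆ D.carrier :=
    (Metric.closedBall_subset_closedBall (mul_le_mul_of_nonneg_right hL hr)).trans hball
  refine (measure_mono fun γ hγ => ?_).trans (h δ hδ x r k hδr hball')
  exact Curve.HasTraversals.mono' hγ le_rfl (mul_le_mul_of_nonneg_right hκ hr)

/-! ## Catalogue annuli are deep -/

/-- The catalogue annuli are deep inside the clean disc: for `q` in the index cube, the closed disc of
radius `100 · 2δM` about the mesh point of the grid site `c + Mq` lies in the disc of radius `4Nδ`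
about the mesh point of `c` (`M = ⌊N/256⌋`, so `|c + Mq - c|_∞ ≤ N + M` and `202 M + 2N ≤ 4N`).
[folklore] -/
theorem closedBall_gridPt_subset (hδ : 0 < δ) (c : Site 2) {N : ℕ} (hN : 256 ≤ N) {q : Site 2}
    (hq : q ∈ box 2 (N / (N / 256) + 1)) :
    Metric.closedBall (meshPoint δ (gridPt c (N / 256) q)) (100 * (2 * δ * (N / 256 : ℕ))) ⊆
      Metric.closedBall (meshPoint δ c) (4 * N * δ) := by
  obtain ⟨hM1, hNM, -⟩ := scaleM_bounds hN
  set M : ℕ := N / 256 with hM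
  set g : Site 2 := gridPt c M q with hg
  have h1 : supDist g c ≤ (M : ℤ) * ((N / M + 1 : ℕ) : ℤ) := supDist_gridPt_le c M hq
  have h2 : M * (N / M + 1) ≤ N + M := by
    have := Nat.mul_div_le N M
    rw [mul_add, mul_one]
    omega
  have h1z : supDist g c ≤ ((M * (N / M + 1) : ℕ) : ℤ) := by rw [Nat.cast_mul]; exact h1
  have h12 : supDist g c ≤ ((N + M : ℕ) : ℤ) := h1z.trans (by exact_mod_cast h2)
  have h3 : (supDist g c : ℝ) ≤ N + M := by
    have h13 : ((supDist g c : ℤ) : ℝ) ≤ (((N + M : ℕ) : ℤ) : ℝ) := by exact_mod_cast h12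
    push_cast at h13
    exact h13
  have h4 : dist (meshPoint δ g) (meshPoint δ c) ≤ 2 * δ * (N + M) :=
    (dist_meshPoint_le hδ.le g c).trans (mul_le_mul_of_nonneg_left h3 (by positivity))
  have hNM' : (256 * M : ℝ) ≤ N := by exact_mod_cast hNM
  intro z hz
  rw [Metric.mem_closedBall] at hz ⊢
  have h5 : dist z (meshPoint δ c) ≤ 100 * (2 * δ * M) + 2 * δ * (N + M) :=
    (dist_triangle z (meshPoint δ g) (meshPoint δ c)).trans (add_le_add hz h4)
  have h6 : 100 * (2 * δ * M) + 2 * δ * (N + M) = δ * (202 * M + 2 * N) := by ring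
  have h7 : δ * (202 * M + 2 * N) ≤ δ * (4 * N) :=
    mul_le_mul_of_nonneg_left (by linarith) hδ.le
  calc dist z (meshPoint δ c) ≤ δ * (202 * M + 2 * N) := h6 ▸ h5
    _ ≤ δ * (4 * N) := h7
    _ = 4 * N * δ := by ring

/-! ## Forward: the traversal tail gives the top state -/

/-- Arithmetic of the union bound: with `K = 1025²` catalogue annuli and `J = (m-1)/K + 1` traversals,
`K · C e^{-c₁ J} ≤ K C e^{c₁} · e^{-(c₁/K)(m+1)}`. [folklore] -/
theorem catalogue_exp_bound {c₁ C : ℝ} (hc₁ : 0 < c₁) (hC : 0 ≤ C) {m : ℕ} (hm : 1 ≤ m) :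
    ((1025 ^ 2 : ℕ) : ℝ) * (C * Real.exp (-(c₁ * ((m - 1) / 1025 ^ 2 + 1 : ℕ)))) ≤
      ((1025 ^ 2 : ℕ) : ℝ) * C * Real.exp c₁ *
        Real.exp (-(c₁ / ((1025 ^ 2 : ℕ) : ℝ) * ((m + 1 : ℕ) : ℝ))) := by
  set J : ℕ := (m - 1) / 1025 ^ 2 + 1 with hJ
  have h1 : m - 1 < (m - 1) / 1025 ^ 2 * 1025 ^ 2 + 1025 ^ 2 := Nat.lt_div_mul_add (by positivity)
  have h2 : m + 1 ≤ 1025 ^ 2 * (J + 1) := by rw [hJ]; omega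
  have h3 : ((m + 1 : ℕ) : ℝ) ≤ ((1025 ^ 2 : ℕ) : ℝ) * ((J : ℝ) + 1) := by
    have : ((m + 1 : ℕ) : ℝ) ≤ ((1025 ^ 2 * (J + 1) : ℕ) : ℝ) := by exact_mod_cast h2
    push_cast at this ⊢
    linarith
  have hK : (0 : ℝ) < ((1025 ^ 2 : ℕ) : ℝ) := by positivity
  have h4 : c₁ / ((1025 ^ 2 : ℕ) : ℝ) * ((m + 1 : ℕ) : ℝ) ≤ c₁ * (J + 1) := by
    rw [div_mul_eq_mul_div, div_le_iff₀ hK]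
    calc c₁ * ((m + 1 : ℕ) : ℝ) ≤ c₁ * (((1025 ^ 2 : ℕ) : ℝ) * ((J : ℝ) + 1)) :=
          mul_le_mul_of_nonneg_left h3 hc₁.le
      _ = c₁ * (J + 1) * ((1025 ^ 2 : ℕ) : ℝ) := by ring
  have h5 : Real.exp (-(c₁ * J)) ≤
      Real.exp c₁ * Real.exp (-(c₁ / ((1025 ^ 2 : ℕ) : ℝ) * ((m + 1 : ℕ) : ℝ))) := by
    rw [← Real.exp_add]
    exact Real.exp_le_exp.2 (by linarith)
  have h6 : 0 ≤ ((1025 ^ 2 : ℕ) : ℝ) * C := by positivity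
  calc ((1025 ^ 2 : ℕ) : ℝ) * (C * Real.exp (-(c₁ * J)))
      = ((1025 ^ 2 : ℕ) : ℝ) * C * Real.exp (-(c₁ * J)) := by ring
    _ ≤ ((1025 ^ 2 : ℕ) : ℝ) * C *
        (Real.exp c₁ * Real.exp (-(c₁ / ((1025 ^ 2 : ℕ) : ℝ) * ((m + 1 : ℕ) : ℝ)))) :=
        mul_le_mul_of_nonneg_left h5 h6
    _ = _ := by ring

/-- **Forward reduction: the fixed-ratio traversal tail gives the top state.**  By
`topHeaviness_of_largeBox` only `N ≥ 256`, `m ≥ 2` matter; there `m` big pieces force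
`(m-2)/1025² + 1` separate traversals of one of the `≤ 1025²` catalogue annuli
`D(δ(c+Mq); 2δM, 40δM)`, `M = ⌊N/256⌋` (`exists_hasTraversals_of_hasPieces`), each of which is deep
(`closedBall_gridPt_subset`: `closedBall (δ(c+Mq)) (100 · 2δM) ⊆ closedBall (δc) (4Nδ) ⊆ D`), and
the union bound gives the tail `1025² C e^{c₁} · e^{-(c₁/1025²) m}`. [folklore] -/
theorem topHeaviness_of_traversalTail (h : DeepTraversalTail 20 100) : TopHeaviness := by
  classical
  refine topHeaviness_of_largeBox fun D a b hab => ?_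
  obtain ⟨C, c₁, δ₀, hc₁, hδ₀, h⟩ := h D a b hab
  set C0 : ℝ := max C 0 with hC0
  have hC00 : 0 ≤ C0 := le_max_right _ _
  refine ⟨256, 2, ((1025 ^ 2 : ℕ) : ℝ) * C0 * Real.exp c₁, c₁ / ((1025 ^ 2 : ℕ) : ℝ), δ₀,
    div_pos hc₁ (by positivity), hδ₀, ?_⟩
  intro δ hδ c N m hN hm hball
  have hδ0 : 0 < δ := hδ.1
  obtain ⟨hM1, hNM, hN512⟩ := scaleM_bounds hN
  obtain ⟨m', rfl⟩ : ∃ m', m = m' + 1 := ⟨m - 1, by omega⟩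
  have hm' : 1 ≤ m' := by omega
  set M : ℕ := N / 256 with hM
  set r : ℝ := 2 * δ * M with hr
  set J : ℕ := (m' - 1) / 1025 ^ 2 + 1 with hJ
  set T : Finset (Site 2) := box 2 (N / M + 1) with hT
  set E : Site 2 → Set (DomainSAW D.carrier δ (a δ) (b δ)) := fun q =>
    {γ | (⟨γ.walk.toCurve (meshPoint δ)⟩ : Curve ℂ).HasTraversals J
      (meshPoint δ (gridPt c M q)) r (20 * r)} with hE
  -- the heaviness event is covered by the catalogue events
  have hcover : {γ : DomainSAW D.carrier δ (a δ) (b δ) | HasPieces γ c N N (m' + 1)} ⊆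
      ⋃ q ∈ T, E q := by
    intro γ hγ
    obtain ⟨q, hq, htr⟩ := exists_hasTraversals_of_hasPieces hδ0 γ hN hm' hγ
    simp only [Set.mem_iUnion]
    refine ⟨q, hq, ?_⟩
    show (⟨γ.walk.toCurve (meshPoint δ)⟩ : Curve ℂ).HasTraversals J
      (meshPoint δ (gridPt c M q)) r (20 * r)
    have h20 : (20 * r : ℝ) = 40 * δ * M := by rw [hr]; ring
    rw [h20]
    exact htr
  -- each catalogue event is exponentially unlikely
  have hr1 : δ ≤ r := by
    have : (1 : ℝ) ≤ M := by exact_mod_cast hM1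
    rw [hr]
    nlinarith
  have heach : ∀ q ∈ T, law D.carrier δ (a δ) (b δ) (E q) ≤
      ENNReal.ofReal (C0 * Real.exp (-(c₁ * J))) := by
    intro q hq
    have hdeep : Metric.closedBall (meshPoint δ (gridPt c M q)) (100 * r) ⊆ D.carrier :=
      (closedBall_gridPt_subset hδ0 c hN hq).trans hball
    exact (h δ hδ _ r J hr1 hdeep).trans (ENNReal.ofReal_le_ofReal
      (mul_le_mul_of_nonneg_right (le_max_left _ _) (Real.exp_pos _).le))
  have hTcard : T.card ≤ 1025 ^ 2 := card_box_gridIdx_le hM1 hN512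
  have hTcard' : (T.card : ℝ≥0∞) ≤ ((1025 ^ 2 : ℕ) : ℝ≥0∞) := by exact_mod_cast hTcard
  -- union bound
  calc law D.carrier δ (a δ) (b δ) {γ | HasPieces γ c N N (m' + 1)}
      ≤ law D.carrier δ (a δ) (b δ) (⋃ q ∈ T, E q) := measure_mono hcover
    _ ≤ ∑ q ∈ T, law D.carrier δ (a δ) (b δ) (E q) := measure_biUnion_finset_le T E
    _ ≤ ∑ q ∈ T, ENNReal.ofReal (C0 * Real.exp (-(c₁ * J))) := Finset.sum_le_sum heach
    _ = (T.card : ℝ≥0∞) * ENNReal.ofReal (C0 * Real.exp (-(c₁ * J))) := by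
        rw [Finset.sum_const, nsmul_eq_mul]
    _ ≤ ((1025 ^ 2 : ℕ) : ℝ≥0∞) * ENNReal.ofReal (C0 * Real.exp (-(c₁ * J))) :=
        mul_le_mul_of_nonneg_right hTcard' bot_le
    _ = ENNReal.ofReal (((1025 ^ 2 : ℕ) : ℝ) * (C0 * Real.exp (-(c₁ * J)))) := by
        rw [ENNReal.ofReal_mul (p := ((1025 ^ 2 : ℕ) : ℝ)) (by positivity),
          ENNReal.ofReal_natCast]
    _ ≤ ENNReal.ofReal (((1025 ^ 2 : ℕ) : ℝ) * C0 * Real.exp c₁ *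
          Real.exp (-(c₁ / ((1025 ^ 2 : ℕ) : ℝ) * ((m' + 1 : ℕ) : ℝ)))) :=
        ENNReal.ofReal_le_ofReal (catalogue_exp_bound hc₁ hC00 hm')

/-! ## Backward: the top state gives the traversal tail -/

/-- Scale arithmetic of the backward direction: with `N = ⌊r/δ⌋ + 4` one has `r/δ + 3 < N`,
`3Nδ + 3δ ≤ 20 r` and `4Nδ + δ ≤ 100 r` as soon as `0 < δ ≤ r`. [folklore] -/
theorem backward_scales {δ r : ℝ} (hδ : 0 < δ) (hδr : δ ≤ r) :
    r / δ + 3 < ((⌊r / δ⌋₊ + 4 : ℕ) : ℝ) ∧ 3 * ((⌊r / δ⌋₊ + 4 : ℕ) : ℝ) * δ + 3 * δ ≤ 20 * r ∧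
      4 * ((⌊r / δ⌋₊ + 4 : ℕ) : ℝ) * δ + δ ≤ 100 * r := by
  have h0 : 0 ≤ r / δ := div_nonneg (hδ.le.trans hδr) hδ.le
  have h1 : r / δ < ⌊r / δ⌋₊ + 1 := Nat.lt_floor_add_one _
  have h2 : (⌊r / δ⌋₊ : ℝ) ≤ r / δ := Nat.floor_le h0
  have h3 : (⌊r / δ⌋₊ : ℝ) * δ ≤ r := by
    have := mul_le_mul_of_nonneg_right h2 hδ.le
    rwa [div_mul_cancel₀ _ hδ.ne'] at this
  push_cast
  refine ⟨by linarith, ?_, ?_⟩ <;> nlinarith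

/-- **Backward reduction: the top state gives the fixed-ratio traversal tail.**  Given
`k` separate traversals of `D(x; r, 20 r)` with `δ ≤ r` and `closedBall x (100 r) ⊆ D`, the landed
`stub_chain_transfer` yields `k/2` big maximal pieces outside the box `B_∞(nearestSite x, N)`,
`N = ⌊r/δ⌋ + 4` (`r/δ + 3 < N`, `3Nδ + 3δ ≤ 20 r`), whose clean disc `closedBall (δc) (4Nδ)` lies in
`closedBall x (21 r) ⊆ D`; so `TopHeaviness` bounds the probability by
`C e^{-c₁ ⌊k/2⌋} ≤ max C 0 · e^{c₁} · e^{-(c₁/2) k}`. [cite: AizenmanBurchard1999, §1.b] -/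
theorem deepTraversalTail_of_topHeaviness (h : TopHeaviness) : DeepTraversalTail 20 100 := by
  intro D a b hab
  obtain ⟨C, c₁, δ₀, hc₁, hδ₀, h⟩ := h D a b hab
  refine ⟨max C 0 * Real.exp c₁, c₁ / 2, δ₀, by positivity, hδ₀, ?_⟩
  intro δ hδ x r k hδr hball
  have hδ0 : 0 < δ := hδ.1
  obtain ⟨hnear, hfar, hdeep⟩ := backward_scales hδ0 hδr
  set N : ℕ := ⌊r / δ⌋₊ + 4 with hN
  set c : Site 2 := nearestSite δ x with hc
  have hN1 : 1 ≤ N := by rw [hN]; omega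
  have hcx : dist (meshPoint δ c) x ≤ δ := dist_meshPoint_nearestSite_le hδ0 x
  have hclean : Metric.closedBall (meshPoint δ c) (4 * N * δ) ⊆ D.carrier := by
    refine subset_trans (Metric.closedBall_subset_closedBall' ?_) hball
    linarith
  -- traversals force heaviness
  have hsub : {γ : DomainSAW D.carrier δ (a δ) (b δ) |
      (⟨γ.walk.toCurve (meshPoint δ)⟩ : Curve ℂ).HasTraversals k x r (20 * r)} ⊆
      {γ | HasPieces γ c N N (k / 2)} := fun γ hγ =>
    stub_chain_transfer hδ0 γ hnear hfar (Curve.HasTraversals.of_le hγ (by omega))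
  refine (measure_mono hsub).trans ((h δ hδ c N (k / 2) hN1 hclean).trans
    (ENNReal.ofReal_le_ofReal ?_))
  -- `C e^{-c₁ ⌊k/2⌋} ≤ max C 0 · e^{c₁} · e^{-(c₁/2) k}`
  have h1 : k < k / 2 * 2 + 2 := Nat.lt_div_mul_add (by norm_num)
  have h2 : (k : ℝ) ≤ 2 * ((k / 2 : ℕ) : ℝ) + 2 := by
    have : ((k : ℕ) : ℝ) ≤ ((k / 2 * 2 + 2 : ℕ) : ℝ) := by exact_mod_cast h1.le
    push_cast at this
    linarith
  have h3 : Real.exp (-(c₁ * ((k / 2 : ℕ) : ℝ))) ≤ Real.exp c₁ * Real.exp (-(c₁ / 2 * k)) := by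
    rw [← Real.exp_add]
    exact Real.exp_le_exp.2 (by nlinarith)
  calc C * Real.exp (-(c₁ * ((k / 2 : ℕ) : ℝ)))
      ≤ max C 0 * Real.exp (-(c₁ * ((k / 2 : ℕ) : ℝ))) :=
        mul_le_mul_of_nonneg_right (le_max_left _ _) (Real.exp_pos _).le
    _ ≤ max C 0 * (Real.exp c₁ * Real.exp (-(c₁ / 2 * k))) :=
        mul_le_mul_of_nonneg_left h3 (le_max_right _ _)
    _ = max C 0 * Real.exp c₁ * Real.exp (-(c₁ / 2 * k)) := by ring

/-- **The top state is equivalent to the fixed-ratio traversal tail** (aspect ratio `20`, depth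
`100 r`): the registered stub `stub_topHeaviness : TopHeaviness` has exactly the analytic content
`DeepTraversalTail 20 100`. [folklore] -/
theorem topHeaviness_iff_deepTraversalTail : TopHeaviness ↔ DeepTraversalTail 20 100 :=
  ⟨deepTraversalTail_of_topHeaviness, topHeaviness_of_traversalTail⟩

end Summit.CriticalPhenomena.SAWScalingLimit.Theorems.TPToTraversalBound.Radial

end
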